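import Literature.NumberTheory.LFunctions.ZetaZeroCountBellottiWong
import Literature.NumberTheory.LFunctions.ZetaZeroWindowsExplicit
import HarnessLib

/-!
# RH-FREE — zeros in windows and multiplicities from the Bellotti–Wong zero-counting bounds («nothing here bears on the truth of RH»)

Topic `Literature/NumberTheory/LFunctions` (RH literature-typing tranche 1, L4 "explicit zero
statistics", gen 9). THEOREMS only (no definitions, no new named facts): the two bounds of
Bellotti–Wong's Theorem 1.1 (`ZetaZeroCountBellottiWong.lean`, named fact `BellottiWong2025_thm11`,
taken as a hypothesis `h`) fed into the tree's window/multiplicity mechanism of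
`ZetaZeroWindowsExplicit.lean` (exactly as done there for Hasanalizade–Shen–Wong,
`zetaZeroCount_hasanalizade_shen_wong.window_le/.multiplicity_le`). Nothing here bears on the truth
of RH.

* `BellottiWong2025_thm11.window_le` — for `T ≥ e`, `H ≥ 0`:
  `N(T+H) − N(T) ≤ (H/2π) log((T+H)/2π) + 0.20152 log(T+H) + 0.4892 log log(T+H) + 16.16688`;
  `.window_le_two` — the same with `0.224 log(T+H) + 0.25134 log log(T+H) + 7.54834` (from the
  second bound of Theorem 1.1; sharper below `exp(447.981)`);
* `BellottiWong2025_thm11.multiplicity_le` — every zero `ρ` with `Im ρ ≥ 7` has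
  `m(ρ) ≤ 0.20152 log γ + 0.4892 log log γ + 16.16688`; `.multiplicity_le_two` —
  `m(ρ) ≤ 0.224 log γ + 0.25134 log log γ + 7.54834` (compare the HSW-fed
  `0.2076 log γ + 0.5146 log log γ + 18.735` and the fact-free `riemannZetaZeroOrder_le_explicit`
  `0.6166 log γ + 6.506`).

Method (Titchmarsh §9.2): `m(ρ) ≤ N(γ) − N(γ − h)` for every `0 < h ≤ 1`, the window bound, and
`h → 0`. These are the `h → 0` limits of the source's Corollary 1.6 mechanism with the constants of
Theorem 1.1 (the source's Cor. 1.6 uses Theorem 1.4 for `S` and gains `1/8`-type terms; we do not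
reproduce its constants).

## References

* C. Bellotti, P.-J. Wong, Math. Comp., to appear (arXiv:2412.15470v2), Thm. 1.1. [BellottiWong2025]
* E. C. Titchmarsh, *The Theory of the Riemann Zeta-Function*, 2nd ed., §9.2. [Titchmarsh1986]
-/

noncomputable section

open Real

namespace Literature.NumberTheory.LFunctions

open SchoenfeldBound

namespace BellottiWong2025_thm11

/-- The main term of Theorem 1.1 is `countMain − 7/8`. [cite: BellottiWong2025, Thm. 1.1] -/
private theorem main_eq (t : ℝ) (ht : 0 < t) :
    t / (2 * π) * Real.log (t / (2 * π * Real.exp 1)) = countMain t - 7 / 8 := by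
  have hπ : 0 < 2 * π := by positivity
  rw [show t / (2 * π * Real.exp 1) = t / (2 * π) / Real.exp 1 by ring,
    Real.log_div (by positivity) (Real.exp_pos 1).ne', Real.log_exp, countMain]
  ring

/-- **Zeros in a window from Bellotti–Wong's Theorem 1.1 (first bound)**: for `T ≥ e` and `H ≥ 0`,
`N(T+H) − N(T) ≤ (H/2π) log((T+H)/2π) + 0.20152 log(T+H) + 0.4892 log log(T+H) + 16.16688`.
[cite: BellottiWong2025, Thm. 1.1] -/
theorem window_le (h : BellottiWong2025_thm11) {T H : ℝ} (hT : Real.exp 1 ≤ T) (hH : 0 ≤ H) :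
    (zetaZeroCount (T + H) : ℝ) - zetaZeroCount T ≤
      H / (2 * π) * Real.log ((T + H) / (2 * π)) + 0.20152 * Real.log (T + H) +
        0.4892 * Real.log (Real.log (T + H)) + 16.16688 := by
  have he := Real.exp_one_gt_d9
  have hT0 : 0 < T := by linarith
  have h1 := h.1 T hT
  have h2 := h.1 (T + H) (by linarith)
  rw [main_eq T hT0] at h1
  rw [main_eq (T + H) (by linarith)] at h2
  have hm := ZetaZeroWindows.countMain_increment_le hT0 hH
  have hL1 : 1 ≤ Real.log T := by rw [Real.le_log_iff_exp_le hT0]; exact hT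
  have hlog : Real.log T ≤ Real.log (T + H) := Real.log_le_log hT0 (by linarith)
  have hll : Real.log (Real.log T) ≤ Real.log (Real.log (T + H)) :=
    Real.log_le_log (by linarith) hlog
  rw [abs_le] at h1 h2
  linarith [h1.1, h2.2]

/-- **Zeros in a window from Bellotti–Wong's Theorem 1.1 (second bound)**: for `T ≥ e` and
`H ≥ 0`, `N(T+H) − N(T) ≤ (H/2π) log((T+H)/2π) + 0.224 log(T+H) + 0.25134 log log(T+H) + 7.54834`.
[cite: BellottiWong2025, Thm. 1.1] -/
theorem window_le_two (h : BellottiWong2025_thm11) {T H : ℝ} (hT : Real.exp 1 ≤ T) (hH : 0 ≤ H) :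
    (zetaZeroCount (T + H) : ℝ) - zetaZeroCount T ≤
      H / (2 * π) * Real.log ((T + H) / (2 * π)) + 0.224 * Real.log (T + H) +
        0.25134 * Real.log (Real.log (T + H)) + 7.54834 := by
  have he := Real.exp_one_gt_d9
  have hT0 : 0 < T := by linarith
  have h1 := h.2 T hT
  have h2 := h.2 (T + H) (by linarith)
  rw [main_eq T hT0] at h1
  rw [main_eq (T + H) (by linarith)] at h2
  have hm := ZetaZeroWindows.countMain_increment_le hT0 hH
  have hL1 : 1 ≤ Real.log T := by rw [Real.le_log_iff_exp_le hT0]; exact hT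
  have hlog : Real.log T ≤ Real.log (T + H) := Real.log_le_log hT0 (by linarith)
  have hll : Real.log (Real.log T) ≤ Real.log (Real.log (T + H)) :=
    Real.log_le_log (by linarith) hlog
  rw [abs_le] at h1 h2
  linarith [h1.1, h2.2]

/-- The `h → 0` step: if for every `0 < h ≤ 1` one has `m(ρ) ≤ (h/2π) log(γ/2π) + K`, and
`γ > 2π`, then `m(ρ) ≤ K`. [cite: Titchmarsh1986, §9.2 (remark after Thm. 9.2)] -/
private theorem le_of_window {ρ : ℂ} {K : ℝ} (hγ : 7 ≤ ρ.im)
    (key : ∀ h' : ℝ, 0 < h' → h' ≤ 1 →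
      (riemannZetaZeroOrder ρ : ℝ) ≤ h' / (2 * π) * Real.log (ρ.im / (2 * π)) + K) :
    (riemannZetaZeroOrder ρ : ℝ) ≤ K := by
  have hπ := Real.pi_pos
  have hπ3 := Real.pi_lt_d2
  have hlog0 : 0 < Real.log (ρ.im / (2 * π)) :=
    Real.log_pos (by rw [lt_div_iff₀ (by positivity)]; linarith)
  refine le_of_forall_pos_le_add fun ε hε ↦ ?_
  set h' : ℝ := min 1 (2 * π * ε / Real.log (ρ.im / (2 * π))) with hh
  have hhpos : 0 < h' := lt_min zero_lt_one (by positivity)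
  have hh1 : h' ≤ 1 := min_le_left _ _
  have hh2 : h' ≤ 2 * π * ε / Real.log (ρ.im / (2 * π)) := min_le_right _ _
  have hterm : h' / (2 * π) * Real.log (ρ.im / (2 * π)) ≤ ε := by
    rw [le_div_iff₀ hlog0] at hh2
    rw [div_mul_eq_mul_div, div_le_iff₀ (by positivity)]
    linarith
  linarith [key h' hhpos hh1]

/-- **Multiplicity from Bellotti–Wong's Theorem 1.1 (first bound)**: every zero `ρ` of `ζ` with
`Im ρ ≥ 7` (all zeros of positive ordinate: `γ₀ > 14`) has
`m(ρ) ≤ 0.20152 log(Im ρ) + 0.4892 log log(Im ρ) + 16.16688`. [cite: BellottiWong2025, Thm. 1.1]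
[cite: Titchmarsh1986, §9.2 (remark after Thm. 9.2)] -/
theorem multiplicity_le (h : BellottiWong2025_thm11) {ρ : ℂ} (hρ : riemannZeta ρ = 0)
    (hγ : 7 ≤ ρ.im) :
    (riemannZetaZeroOrder ρ : ℝ) ≤
      0.20152 * Real.log ρ.im + 0.4892 * Real.log (Real.log ρ.im) + 16.16688 := by
  have he := Real.exp_one_lt_d9
  refine le_of_window hγ fun h' hh hh1 ↦ ?_
  have hw := riemannZetaZeroOrder_le_window (T₁ := ρ.im - h') hρ (by linarith) (by linarith)
  have hc := window_le h (T := ρ.im - h') (H := h') (by linarith) hh.le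
  rw [sub_add_cancel] at hc
  linarith

/-- **Multiplicity from Bellotti–Wong's Theorem 1.1 (second bound)**: every zero `ρ` of `ζ` with
`Im ρ ≥ 7` has `m(ρ) ≤ 0.224 log(Im ρ) + 0.25134 log log(Im ρ) + 7.54834` (sharper than the first
bound below `exp(447.981)` and than the fact-free `riemannZetaZeroOrder_le_explicit`
`0.6166 log γ + 6.506` from `γ ≥ 31` on). [cite: BellottiWong2025, Thm. 1.1]
[cite: Titchmarsh1986, §9.2 (remark after Thm. 9.2)] -/
theorem multiplicity_le_two (h : BellottiWong2025_thm11) {ρ : ℂ} (hρ : riemannZeta ρ = 0)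
    (hγ : 7 ≤ ρ.im) :
    (riemannZetaZeroOrder ρ : ℝ) ≤
      0.224 * Real.log ρ.im + 0.25134 * Real.log (Real.log ρ.im) + 7.54834 := by
  have he := Real.exp_one_lt_d9
  refine le_of_window hγ fun h' hh hh1 ↦ ?_
  have hw := riemannZetaZeroOrder_le_window (T₁ := ρ.im - h') hρ (by linarith) (by linarith)
  have hc := window_le_two h (T := ρ.im - h') (H := h') (by linarith) hh.le
  rw [sub_add_cancel] at hc
  linarith

/-- Unit windows above `e`: `N(T+1) − N(T) ≤ (1/2π) log((T+1)/2π) + 0.224 log(T+1) +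
0.25134 log log(T+1) + 7.54834` for `T ≥ e` (second bound; no restriction to Platt's height,
unlike the printed Cor. 1.6 (a)/(c)). [cite: BellottiWong2025, Thm. 1.1] -/
theorem unit_window_le (h : BellottiWong2025_thm11) {T : ℝ} (hT : Real.exp 1 ≤ T) :
    (zetaZeroCount (T + 1) : ℝ) - zetaZeroCount T ≤
      1 / (2 * π) * Real.log ((T + 1) / (2 * π)) + 0.224 * Real.log (T + 1) +
        0.25134 * Real.log (Real.log (T + 1)) + 7.54834 := by
  have := h.window_le_two hT zero_le_one
  simpa using this

end BellottiWong2025_thm11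

end Literature.NumberTheory.LFunctions

end
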